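import Summits.AtomisticToContinuum.Crystallization.Theses.PricedLinkCensus

/-!
# Far-site locality: the near/far-Barlow predicate of a site only sees the sites within `3.57` of it

Helper (FAR-LOCALITY) for the stub `stub_barlowFarSiteGap` (FAR) of the line `near-far-split`
(`Cruxes/TruncatedCensusGap/Lines/near_far_split.lean`) of the crux
`PricedLinkCensus.TruncatedCensusGap` (item stmt-AtomisticToContinuum-14230).  It is the
FAR-analogue of the landed CHARGE LOCALITY `isChargeFree_sub_iff`
(`…TruncatedCensusGapChargeLocality.lean`) and UNDER-COORDINATION LOCALITY
`underCoordinated_sub_iff` (`…TruncatedCensusGapUnderCoordinationLocality.lean`).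

The line cuts the sites of a finite configuration `y : Fin N → ℝ³` by the GEOMETRY of their
closed `3a`-patch: the site `i` is **near-Barlow** (coarse) when for some scale
`a ∈ [93/100, 51/50]`, layer spacing `c ∈ [78a/100, 86a/100]`, Hägg word `s` and rigid motion
`g : ℝ³ ≃ᵃⁱ[ℝ] ℝ³`

* (separation) every site within `3a` of `y i` has all other sites at distance `≥ a/2`,
* (sites → stacking) every site within `3a` of `y i` is within `a/50` of a point of
  `g '' barlowStacking a c s`,
* (stacking → sites) every point of `g '' barlowStacking a c s` within `3a` of `y i` is within
  `a/50` of a site;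

this is the long predicate `∃ a c s g, …` inlined in the stub, whose complement (the FAR sites)
is counted by `Nat.card {i // ¬ ∃ a c s g, …}`.  No definition is introduced here: every
statement spells the predicate out, for a configuration `y : ι → ℝ³` on an arbitrary index type
(so that it can be read on `Fin N`, on the points `Q.points` of a periodic configuration via
`Subtype.val`, and on block index types).

**Theorem (`nearBarlow_apply_iff_comp`).**  For `y : ι → ℝ³` and an injective re-indexing
`f : κ → ι` whose range contains every site within `357/100 = (7/2)·(51/50)` of `y (f i)`, the
site `f i` is near-Barlow in `y` iff `i` is near-Barlow in the sub-configuration `y ∘ f`.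
Indeed the three clauses only involve sites within `3a + a/2 ≤ 357/100` of `y (f i)`
(separation: a site closer than `a/2` to a patch site is within `7a/2` of the centre; the
matching witnesses lie within `3a + a/50`).  Registered `Fin`-indexed forms (`f : Fin M ↪ Fin N`):
`nearBarlow_sub_iff`, `farBarlow_sub_iff`.  Since `357/100 < 8`, the far periodisation
`y + (8D+8)ℤ³` and the deep block points of the periodic-form files read the predicate
correctly.  Also: invariance under re-indexing by an equivalence (`nearBarlow_comp_equiv_iff`)
and under rigid motions / translations of the whole configuration
(`nearBarlow_isometry_comp_iff`, `nearBarlow_add_const_comp_iff`: compose the chart `g` with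
the motion).

All `[folklore]` bookkeeping; the content of (FAR) is untouched.
-/

noncomputable section

namespace Summit.AtomisticToContinuum.Crystallization.Theorems.PricedLinkCensusTruncatedCensusGap

open Literature.MathematicalPhysics.StatisticalMechanics

section General

variable {ι κ : Type*}

/-- **Re-indexing invariance.**  Relabelling the sites by an equivalence `e : κ ≃ ι` does not
change the near-Barlow predicate: `i` is near-Barlow in `y ∘ e` iff `e i` is near-Barlow in `y`
(same scale, spacing, word and motion). [folklore] -/
theorem nearBarlow_comp_equiv_iff (y : ι → EuclideanSpace ℝ (Fin 3)) (e : κ ≃ ι) (i : κ) :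
    (∃ (a c : ℝ) (s : ℤ → ℤ) (g : EuclideanSpace ℝ (Fin 3) ≃ᵃⁱ[ℝ] EuclideanSpace ℝ (Fin 3)), 93 / 100 ≤ a ∧ a ≤ 51 / 50 ∧ 78 / 100 * a ≤ c ∧ c ≤ 86 / 100 * a ∧ Literature.MathematicalPhysics.StatisticalMechanics.IsHaggSeq s ∧ (∀ j k, j ≠ k → dist ((y ∘ ⇑e) j) ((y ∘ ⇑e) i) ≤ 3 * a → a / 2 ≤ dist ((y ∘ ⇑e) j) ((y ∘ ⇑e) k)) ∧ (∀ j, dist ((y ∘ ⇑e) j) ((y ∘ ⇑e) i) ≤ 3 * a → ∃ z ∈ Literature.MathematicalPhysics.StatisticalMechanics.barlowStacking a c s, dist ((y ∘ ⇑e) j) (g z) ≤ a / 50) ∧ (∀ z ∈ Literature.MathematicalPhysics.StatisticalMechanics.barlowStacking a c s, dist (g z) ((y ∘ ⇑e) i) ≤ 3 * a → ∃ j, dist ((y ∘ ⇑e) j) (g z) ≤ a / 50)) ↔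
      (∃ (a c : ℝ) (s : ℤ → ℤ) (g : EuclideanSpace ℝ (Fin 3) ≃ᵃⁱ[ℝ] EuclideanSpace ℝ (Fin 3)), 93 / 100 ≤ a ∧ a ≤ 51 / 50 ∧ 78 / 100 * a ≤ c ∧ c ≤ 86 / 100 * a ∧ Literature.MathematicalPhysics.StatisticalMechanics.IsHaggSeq s ∧ (∀ j k, j ≠ k → dist (y j) (y (e i)) ≤ 3 * a → a / 2 ≤ dist (y j) (y k)) ∧ (∀ j, dist (y j) (y (e i)) ≤ 3 * a → ∃ z ∈ Literature.MathematicalPhysics.StatisticalMechanics.barlowStacking a c s, dist (y j) (g z) ≤ a / 50) ∧ (∀ z ∈ Literature.MathematicalPhysics.StatisticalMechanics.barlowStacking a c s, dist (g z) (y (e i)) ≤ 3 * a → ∃ j, dist (y j) (g z) ≤ a / 50)) := by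
  constructor
  · rintro ⟨a, c, s, g, ha1, ha2, hc1, hc2, hs, hsep, hm1, hm2⟩
    refine ⟨a, c, s, g, ha1, ha2, hc1, hc2, hs, ?_, ?_, ?_⟩
    · intro j k hjk hj
      simpa using hsep (e.symm j) (e.symm k) (by simpa using hjk) (by simpa using hj)
    · intro j hj
      simpa using hm1 (e.symm j) (by simpa using hj)
    · intro z hz hzi
      obtain ⟨j, hj⟩ := hm2 z hz (by simpa using hzi)
      exact ⟨e j, by simpa using hj⟩
  · rintro ⟨a, c, s, g, ha1, ha2, hc1, hc2, hs, hsep, hm1, hm2⟩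
    refine ⟨a, c, s, g, ha1, ha2, hc1, hc2, hs, ?_, ?_, ?_⟩
    · intro j k hjk hj
      simpa using hsep (e j) (e k) (by simpa using hjk) (by simpa using hj)
    · intro j hj
      simpa using hm1 (e j) (by simpa using hj)
    · intro z hz hzi
      obtain ⟨j, hj⟩ := hm2 z hz (by simpa using hzi)
      exact ⟨e.symm j, by simpa using hj⟩

/-- Moving the whole configuration by a rigid motion `φ` keeps near-Barlow sites near-Barlow
(compose the chart `g` with `φ`). [folklore] -/
theorem nearBarlow_isometry_comp_of (φ : EuclideanSpace ℝ (Fin 3) ≃ᵃⁱ[ℝ] EuclideanSpace ℝ (Fin 3)) (y : ι → EuclideanSpace ℝ (Fin 3)) (i : ι)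
    (h : ∃ (a c : ℝ) (s : ℤ → ℤ) (g : EuclideanSpace ℝ (Fin 3) ≃ᵃⁱ[ℝ] EuclideanSpace ℝ (Fin 3)), 93 / 100 ≤ a ∧ a ≤ 51 / 50 ∧ 78 / 100 * a ≤ c ∧ c ≤ 86 / 100 * a ∧ Literature.MathematicalPhysics.StatisticalMechanics.IsHaggSeq s ∧ (∀ j k, j ≠ k → dist (y j) (y i) ≤ 3 * a → a / 2 ≤ dist (y j) (y k)) ∧ (∀ j, dist (y j) (y i) ≤ 3 * a → ∃ z ∈ Literature.MathematicalPhysics.StatisticalMechanics.barlowStacking a c s, dist (y j) (g z) ≤ a / 50) ∧ (∀ z ∈ Literature.MathematicalPhysics.StatisticalMechanics.barlowStacking a c s, dist (g z) (y i) ≤ 3 * a → ∃ j, dist (y j) (g z) ≤ a / 50)) :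
    ∃ (a c : ℝ) (s : ℤ → ℤ) (g : EuclideanSpace ℝ (Fin 3) ≃ᵃⁱ[ℝ] EuclideanSpace ℝ (Fin 3)), 93 / 100 ≤ a ∧ a ≤ 51 / 50 ∧ 78 / 100 * a ≤ c ∧ c ≤ 86 / 100 * a ∧ Literature.MathematicalPhysics.StatisticalMechanics.IsHaggSeq s ∧ (∀ j k, j ≠ k → dist ((⇑φ ∘ y) j) ((⇑φ ∘ y) i) ≤ 3 * a → a / 2 ≤ dist ((⇑φ ∘ y) j) ((⇑φ ∘ y) k)) ∧ (∀ j, dist ((⇑φ ∘ y) j) ((⇑φ ∘ y) i) ≤ 3 * a → ∃ z ∈ Literature.MathematicalPhysics.StatisticalMechanics.barlowStacking a c s, dist ((⇑φ ∘ y) j) (g z) ≤ a / 50) ∧ (∀ z ∈ Literature.MathematicalPhysics.StatisticalMechanics.barlowStacking a c s, dist (g z) ((⇑φ ∘ y) i) ≤ 3 * a → ∃ j, dist ((⇑φ ∘ y) j) (g z) ≤ a / 50) := by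
  obtain ⟨a, c, s, g, ha1, ha2, hc1, hc2, hs, hsep, hm1, hm2⟩ := h
  refine ⟨a, c, s, g.trans φ, ha1, ha2, hc1, hc2, hs, ?_, ?_, ?_⟩
  · intro j k hjk hj
    simp only [Function.comp_apply, AffineIsometryEquiv.dist_map] at hj ⊢
    exact hsep j k hjk hj
  · intro j hj
    simp only [Function.comp_apply, AffineIsometryEquiv.dist_map,
      AffineIsometryEquiv.coe_trans] at hj ⊢
    exact hm1 j hj
  · intro z hz hzi
    simp only [Function.comp_apply, AffineIsometryEquiv.dist_map,
      AffineIsometryEquiv.coe_trans] at hzi ⊢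
    exact hm2 z hz hzi

/-- **Rigid-motion invariance.**  For a rigid motion `φ` of `ℝ³`, the site `i` is near-Barlow
in `φ ∘ y` iff it is near-Barlow in `y`. [folklore] -/
theorem nearBarlow_isometry_comp_iff (φ : EuclideanSpace ℝ (Fin 3) ≃ᵃⁱ[ℝ] EuclideanSpace ℝ (Fin 3)) (y : ι → EuclideanSpace ℝ (Fin 3)) (i : ι) :
    (∃ (a c : ℝ) (s : ℤ → ℤ) (g : EuclideanSpace ℝ (Fin 3) ≃ᵃⁱ[ℝ] EuclideanSpace ℝ (Fin 3)), 93 / 100 ≤ a ∧ a ≤ 51 / 50 ∧ 78 / 100 * a ≤ c ∧ c ≤ 86 / 100 * a ∧ Literature.MathematicalPhysics.StatisticalMechanics.IsHaggSeq s ∧ (∀ j k, j ≠ k → dist ((⇑φ ∘ y) j) ((⇑φ ∘ y) i) ≤ 3 * a → a / 2 ≤ dist ((⇑φ ∘ y) j) ((⇑φ ∘ y) k)) ∧ (∀ j, dist ((⇑φ ∘ y) j) ((⇑φ ∘ y) i) ≤ 3 * a → ∃ z ∈ Literature.MathematicalPhysics.StatisticalMechanics.barlowStacking a c s, dist ((⇑φ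 ∘ y) j) (g z) ≤ a / 50) ∧ (∀ z ∈ Literature.MathematicalPhysics.StatisticalMechanics.barlowStacking a c s, dist (g z) ((⇑φ ∘ y) i) ≤ 3 * a → ∃ j, dist ((⇑φ ∘ y) j) (g z) ≤ a / 50)) ↔
      (∃ (a c : ℝ) (s : ℤ → ℤ) (g : EuclideanSpace ℝ (Fin 3) ≃ᵃⁱ[ℝ] EuclideanSpace ℝ (Fin 3)), 93 / 100 ≤ a ∧ a ≤ 51 / 50 ∧ 78 / 100 * a ≤ c ∧ c ≤ 86 / 100 * a ∧ Literature.MathematicalPhysics.StatisticalMechanics.IsHaggSeq s ∧ (∀ j k, j ≠ k → dist (y j) (y i) ≤ 3 * a → a / 2 ≤ dist (y j) (y k)) ∧ (∀ j, dist (y j) (y i) ≤ 3 * a → ∃ z ∈ Literature.MathematicalPhysics.StatisticalMechanics.barlowStacking a c s, dist (y j) (g z) ≤ a / 50) ∧ (∀ z ∈ Literature.MathematicalPhysics.StatisticalMechanics.barlowStacking a c s, dist (g z) (y i) ≤ 3 * a → ∃ j, dist (y j) (g z) ≤ a / 50)) := by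
  refine ⟨fun h => ?_, nearBarlow_isometry_comp_of φ y i⟩
  have h' := nearBarlow_isometry_comp_of φ.symm (⇑φ ∘ y) i h
  have hcomp : (⇑φ.symm ∘ (⇑φ ∘ y)) = y := by
    funext j
    simp
  rwa [hcomp] at h'

/-- **Translation invariance.**  Translating the whole configuration by `v` does not change
the near-Barlow predicate. [folklore] -/
theorem nearBarlow_add_const_comp_iff (v : EuclideanSpace ℝ (Fin 3)) (y : ι → EuclideanSpace ℝ (Fin 3)) (i : ι) :
    (∃ (a c : ℝ) (s : ℤ → ℤ) (g : EuclideanSpace ℝ (Fin 3) ≃ᵃⁱ[ℝ] EuclideanSpace ℝ (Fin 3)), 93 / 100 ≤ a ∧ a ≤ 51 / 50 ∧ 78 / 100 * a ≤ c ∧ c ≤ 86 / 100 * a ∧ Literature.MathematicalPhysics.StatisticalMechanics.IsHaggSeq s ∧ (∀ j k, j ≠ k → dist (((fun x : EuclideanSpace ℝ (Fin 3) => x + v) ∘ y) j) (((fun x : EuclideanSpace ℝ (Fin 3) => x + v) ∘ y) i) ≤ 3 * a → a / 2 ≤ dist (((fun x : EuclideanSpace ℝ (Fin 3) => x + v) ∘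 y) j) (((fun x : EuclideanSpace ℝ (Fin 3) => x + v) ∘ y) k)) ∧ (∀ j, dist (((fun x : EuclideanSpace ℝ (Fin 3) => x + v) ∘ y) j) (((fun x : EuclideanSpace ℝ (Fin 3) => x + v) ∘ y) i) ≤ 3 * a → ∃ z ∈ Literature.MathematicalPhysics.StatisticalMechanics.barlowStacking a c s, dist (((fun x : EuclideanSpace ℝ (Fin 3) => x + v) ∘ y) j) (g z) ≤ a / 50) ∧ (∀ z ∈ Literature.MathematicalPhysics.StatisticalMechanics.barlowStacking a c s, dist (g z) (((fun x : EuclideanSpace ℝ (Fin 3) => x + v) ∘ y) i) ≤ 3 * a → ∃ j, dist (((fun x : EuclideanSpace ℝ (Fin 3) => x + v) ∘ y) j) (g z) ≤ a / 50)) ↔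
      (∃ (a c : ℝ) (s : ℤ → ℤ) (g : EuclideanSpace ℝ (Fin 3) ≃ᵃⁱ[ℝ] EuclideanSpace ℝ (Fin 3)), 93 / 100 ≤ a ∧ a ≤ 51 / 50 ∧ 78 / 100 * a ≤ c ∧ c ≤ 86 / 100 * a ∧ Literature.MathematicalPhysics.StatisticalMechanics.IsHaggSeq s ∧ (∀ j k, j ≠ k → dist (y j) (y i) ≤ 3 * a → a / 2 ≤ dist (y j) (y k)) ∧ (∀ j, dist (y j) (y i) ≤ 3 * a → ∃ z ∈ Literature.MathematicalPhysics.StatisticalMechanics.barlowStacking a c s, dist (y j) (g z) ≤ a / 50) ∧ (∀ z ∈ Literature.MathematicalPhysics.StatisticalMechanics.barlowStacking a c s, dist (g z) (y i) ≤ 3 * a → ∃ j, dist (y j) (g z) ≤ a / 50)) := by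
  have h : (fun x : EuclideanSpace ℝ (Fin 3) => x + v) =
      ⇑(AffineIsometryEquiv.vaddConst ℝ v : EuclideanSpace ℝ (Fin 3) ≃ᵃⁱ[ℝ] EuclideanSpace ℝ (Fin 3)) := by
    funext x
    simp [vadd_eq_add]
  rw [h]
  exact nearBarlow_isometry_comp_iff _ y i

/-- **Far-site locality (general form).**  Let `y : ι → ℝ³` be a configuration and
`f : κ → ι` an injective re-indexing whose range contains every site within
`357/100 = (7/2)·(51/50)` of `y (f i)`.  Then `f i` is near-Barlow in `y` iff `i` is
near-Barlow in the sub-configuration `y ∘ f` (same scale, spacing, word and motion): the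
separation clause only involves sites within `3a + a/2 ≤ 357/100` of `y (f i)`, the matching
witnesses lie within `3a + a/50` of it. [folklore] -/
theorem nearBarlow_apply_iff_comp (y : ι → EuclideanSpace ℝ (Fin 3)) {f : κ → ι} (hf : Function.Injective f)
    (i : κ) (hS : ∀ k, dist (y k) (y (f i)) ≤ 357 / 100 → k ∈ Set.range f) :
    (∃ (a c : ℝ) (s : ℤ → ℤ) (g : EuclideanSpace ℝ (Fin 3) ≃ᵃⁱ[ℝ] EuclideanSpace ℝ (Fin 3)), 93 / 100 ≤ a ∧ a ≤ 51 / 50 ∧ 78 / 100 * a ≤ c ∧ c ≤ 86 / 100 * a ∧ Literature.MathematicalPhysics.StatisticalMechanics.IsHaggSeq s ∧ (∀ j k, j ≠ k → dist (y j) (y (f i)) ≤ 3 * a → a / 2 ≤ dist (y j) (y k)) ∧ (∀ j, dist (y j) (y (f i)) ≤ 3 * a → ∃ z ∈ Literature.MathematicalPhysics.StatisticalMechanics.barlowStacking a c s, dist (y j) (g z) ≤ a / 50) ∧ (∀ z ∈ Literature.MathematicalPhysics.StatisticalMechanics.barlowStacking a c s, dist (g z) (y (f i)) ≤ 3 * a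 → ∃ j, dist (y j) (g z) ≤ a / 50)) ↔
      (∃ (a c : ℝ) (s : ℤ → ℤ) (g : EuclideanSpace ℝ (Fin 3) ≃ᵃⁱ[ℝ] EuclideanSpace ℝ (Fin 3)), 93 / 100 ≤ a ∧ a ≤ 51 / 50 ∧ 78 / 100 * a ≤ c ∧ c ≤ 86 / 100 * a ∧ Literature.MathematicalPhysics.StatisticalMechanics.IsHaggSeq s ∧ (∀ j k, j ≠ k → dist ((y ∘ f) j) ((y ∘ f) i) ≤ 3 * a → a / 2 ≤ dist ((y ∘ f) j) ((y ∘ f) k)) ∧ (∀ j, dist ((y ∘ f) j) ((y ∘ f) i) ≤ 3 * a → ∃ z ∈ Literature.MathematicalPhysics.StatisticalMechanics.barlowStacking a c s, dist ((y ∘ f) j) (g z) ≤ a / 50) ∧ (∀ z ∈ Literature.MathematicalPhysics.StatisticalMechanics.barlowStacking a c s, dist (g z) ((y ∘ f) i) ≤ 3 * a → ∃ j, dist ((y ∘ f) j) (g z) ≤ a / 50)) := by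
  constructor
  · rintro ⟨a, c, s, g, ha1, ha2, hc1, hc2, hs, hsep, hm1, hm2⟩
    refine ⟨a, c, s, g, ha1, ha2, hc1, hc2, hs, ?_, ?_, ?_⟩
    · intro j k hjk hj
      exact hsep (f j) (f k) (hf.ne hjk) hj
    · intro j hj
      exact hm1 (f j) hj
    · intro z hz hzi
      have hzi' : dist (g z) (y (f i)) ≤ 3 * a := hzi
      obtain ⟨j', hj'⟩ := hm2 z hz hzi'
      have hmem : j' ∈ Set.range f := by
        refine hS j' ?_
        have := dist_triangle (y j') (g z) (y (f i))
        linarith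
      obtain ⟨j, rfl⟩ := hmem
      exact ⟨j, hj'⟩
  · rintro ⟨a, c, s, g, ha1, ha2, hc1, hc2, hs, hsep, hm1, hm2⟩
    refine ⟨a, c, s, g, ha1, ha2, hc1, hc2, hs, ?_, ?_, ?_⟩
    · intro j k hjk hj
      have hjmem : j ∈ Set.range f := hS j (by linarith)
      obtain ⟨j₀, rfl⟩ := hjmem
      by_contra hlt
      push Not at hlt
      have hkmem : k ∈ Set.range f := by
        refine hS k ?_
        have := dist_triangle (y k) (y (f j₀)) (y (f i))
        rw [dist_comm (y k) (y (f j₀))] at this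
        linarith
      obtain ⟨k₀, rfl⟩ := hkmem
      have hne : j₀ ≠ k₀ := fun h => hjk (by rw [h])
      have := hsep j₀ k₀ hne hj
      exact absurd this (not_le.2 hlt)
    · intro j hj
      have hjmem : j ∈ Set.range f := hS j (by linarith)
      obtain ⟨j₀, rfl⟩ := hjmem
      exact hm1 j₀ hj
    · intro z hz hzi
      obtain ⟨j, hj⟩ := hm2 z hz hzi
      exact ⟨f j, hj⟩

/-- **Far-site locality (general form, far version).**  Under the same hypotheses, `f i` is FAR
(not near-Barlow) in `y` iff `i` is far in `y ∘ f`. [folklore] -/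
theorem farBarlow_apply_iff_comp (y : ι → EuclideanSpace ℝ (Fin 3)) {f : κ → ι} (hf : Function.Injective f)
    (i : κ) (hS : ∀ k, dist (y k) (y (f i)) ≤ 357 / 100 → k ∈ Set.range f) :
    (¬ ∃ (a c : ℝ) (s : ℤ → ℤ) (g : EuclideanSpace ℝ (Fin 3) ≃ᵃⁱ[ℝ] EuclideanSpace ℝ (Fin 3)), 93 / 100 ≤ a ∧ a ≤ 51 / 50 ∧ 78 / 100 * a ≤ c ∧ c ≤ 86 / 100 * a ∧ Literature.MathematicalPhysics.StatisticalMechanics.IsHaggSeq s ∧ (∀ j k, j ≠ k → dist (y j) (y (f i)) ≤ 3 * a → a / 2 ≤ dist (y j) (y k)) ∧ (∀ j, dist (y j) (y (f i)) ≤ 3 * a → ∃ z ∈ Literature.MathematicalPhysics.StatisticalMechanics.barlowStacking a c s, dist (y j) (g z) ≤ a / 50) ∧ (∀ z ∈ Literature.MathematicalPhysics.StatisticalMechanics.barlowStacking a c s, dist (g z) (y (f i)) ≤ 3 * a → ∃ j, dist (y j) (g z) ≤ a / 50)) ↔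
      (¬ ∃ (a c : ℝ) (s : ℤ → ℤ) (g : EuclideanSpace ℝ (Fin 3) ≃ᵃⁱ[ℝ] EuclideanSpace ℝ (Fin 3)), 93 / 100 ≤ a ∧ a ≤ 51 / 50 ∧ 78 / 100 * a ≤ c ∧ c ≤ 86 / 100 * a ∧ Literature.MathematicalPhysics.StatisticalMechanics.IsHaggSeq s ∧ (∀ j k, j ≠ k → dist ((y ∘ f) j) ((y ∘ f) i) ≤ 3 * a → a / 2 ≤ dist ((y ∘ f) j) ((y ∘ f) k)) ∧ (∀ j, dist ((y ∘ f) j) ((y ∘ f) i) ≤ 3 * a → ∃ z ∈ Literature.MathematicalPhysics.StatisticalMechanics.barlowStacking a c s, dist ((y ∘ f) j) (g z) ≤ a / 50) ∧ (∀ z ∈ Literature.MathematicalPhysics.StatisticalMechanics.barlowStacking a c s, dist (g z) ((y ∘ f) i) ≤ 3 * a → ∃ j, dist ((y ∘ f) j) (g z) ≤ a / 50)) :=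
  not_congr (nearBarlow_apply_iff_comp y hf i hS)

end General

/-! ## Registered `Fin`-indexed forms -/

/-- **Far-site locality** (registered `Fin`-indexed form, the FAR-analogue of
`isChargeFree_sub_iff` / `underCoordinated_sub_iff`): for a sub-configuration `y ∘ f`
(`f : Fin M ↪ Fin N`) of a finite configuration `y : Fin N → ℝ³` whose range contains every
site within `357/100` of `y (f i)`, the site `f i` is near-Barlow in `y` iff `i` is
near-Barlow in `y ∘ f`. [folklore] -/
theorem nearBarlow_sub_iff : ∀ (N M : ℕ) (y : Fin N → EuclideanSpace ℝ (Fin 3)) (f : Fin M ↪ Fin N) (i : Fin M), (∀ k : Fin N, dist (y k) (y (f i)) ≤ 357 / 100 → k ∈ Set.range f) → ((∃ (a c : ℝ) (s : ℤ → ℤ) (g : EuclideanSpace ℝ (Fin 3) ≃ᵃⁱ[ℝ] EuclideanSpace ℝ (Fin 3)), 93 / 100 ≤ a ∧ a ≤ 51 / 50 ∧ 78 / 100 * a ≤ c ∧ c ≤ 86 / 100 * a ∧ Literature.MathematicalPhysics.StatisticalMechanics.IsHaggSeq s ∧ (∀ j k : Fin N, j ≠ k → dist (y j) (y (f i)) ≤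 3 * a → a / 2 ≤ dist (y j) (y k)) ∧ (∀ j : Fin N, dist (y j) (y (f i)) ≤ 3 * a → ∃ z ∈ Literature.MathematicalPhysics.StatisticalMechanics.barlowStacking a c s, dist (y j) (g z) ≤ a / 50) ∧ (∀ z ∈ Literature.MathematicalPhysics.StatisticalMechanics.barlowStacking a c s, dist (g z) (y (f i)) ≤ 3 * a → ∃ j : Fin N, dist (y j) (g z) ≤ a / 50)) ↔ (∃ (a c : ℝ) (s : ℤ → ℤ) (g : EuclideanSpace ℝ (Fin 3) ≃ᵃⁱ[ℝ] EuclideanSpace ℝ (Fin 3)), 93 / 100 ≤ a ∧ a ≤ 51 / 50 ∧ 78 / 100 * a ≤ c ∧ c ≤ 86 / 100 * a ∧ Literature.MathematicalPhysics.StatisticalMechanics.IsHaggSeq s ∧ (∀ j k : Fin M, j ≠ k → dist ((y ∘ f) j) ((y ∘ f) i) ≤ 3 * a → a / 2 ≤ dist ((y ∘ f) j) ((y ∘ f) k)) ∧ (∀ j : Fin M, dist ((y ∘ f) j) ((y ∘ f) i) ≤ 3 * a → ∃ z ∈ Literature.MathematicalPhysics.StatisticalMechanics.barlowStacking a c s,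 dist ((y ∘ f) j) (g z) ≤ a / 50) ∧ (∀ z ∈ Literature.MathematicalPhysics.StatisticalMechanics.barlowStacking a c s, dist (g z) ((y ∘ f) i) ≤ 3 * a → ∃ j : Fin M, dist ((y ∘ f) j) (g z) ≤ a / 50))) := by
  intro N M y f i hS
  exact nearBarlow_apply_iff_comp y f.injective i hS

/-- **Far-site locality, far version** (registered `Fin`-indexed form): with every site within
`357/100` of `y (f i)` in the range of `f : Fin M ↪ Fin N`, the site `f i` is FAR (not
near-Barlow) in `y` iff `i` is far in `y ∘ f` — the predicate counted by
`Nat.card {i // ¬ ∃ a c s g, …}` in the stub `stub_barlowFarSiteGap`. [folklore] -/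
theorem farBarlow_sub_iff : ∀ (N M : ℕ) (y : Fin N → EuclideanSpace ℝ (Fin 3)) (f : Fin M ↪ Fin N) (i : Fin M), (∀ k : Fin N, dist (y k) (y (f i)) ≤ 357 / 100 → k ∈ Set.range f) → ((¬ ∃ (a c : ℝ) (s : ℤ → ℤ) (g : EuclideanSpace ℝ (Fin 3) ≃ᵃⁱ[ℝ] EuclideanSpace ℝ (Fin 3)), 93 / 100 ≤ a ∧ a ≤ 51 / 50 ∧ 78 / 100 * a ≤ c ∧ c ≤ 86 / 100 * a ∧ Literature.MathematicalPhysics.StatisticalMechanics.IsHaggSeq s ∧ (∀ j k : Fin N, j ≠ k → dist (y j) (y (f i)) ≤ 3 * a → a / 2 ≤ dist (y j) (y k)) ∧ (∀ j : Fin N, dist (y j) (y (f i)) ≤ 3 * a → ∃ z ∈ Literature.MathematicalPhysics.StatisticalMechanics.barlowStacking a c s, dist (y j) (g z) ≤ a / 50) ∧ (∀ z ∈ Literature.MathematicalPhysics.StatisticalMechanics.barlowStacking a c s, dist (g z) (y (f i)) ≤ 3 * a → ∃ j : Fin N, dist (y j) (g z) ≤ a / 50)) ↔ (¬ ∃ (a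 c : ℝ) (s : ℤ → ℤ) (g : EuclideanSpace ℝ (Fin 3) ≃ᵃⁱ[ℝ] EuclideanSpace ℝ (Fin 3)), 93 / 100 ≤ a ∧ a ≤ 51 / 50 ∧ 78 / 100 * a ≤ c ∧ c ≤ 86 / 100 * a ∧ Literature.MathematicalPhysics.StatisticalMechanics.IsHaggSeq s ∧ (∀ j k : Fin M, j ≠ k → dist ((y ∘ f) j) ((y ∘ f) i) ≤ 3 * a → a / 2 ≤ dist ((y ∘ f) j) ((y ∘ f) k)) ∧ (∀ j : Fin M, dist ((y ∘ f) j) ((y ∘ f) i) ≤ 3 * a → ∃ z ∈ Literature.MathematicalPhysics.StatisticalMechanics.barlowStacking a c s, dist ((y ∘ f) j) (g z) ≤ a / 50) ∧ (∀ z ∈ Literature.MathematicalPhysics.StatisticalMechanics.barlowStacking a c s, dist (g z) ((y ∘ f) i) ≤ 3 * a → ∃ j : Fin M, dist ((y ∘ f) j) (g z) ≤ a / 50))) := by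
  intro N M y f i hS
  exact farBarlow_apply_iff_comp y f.injective i hS

end Summit.AtomisticToContinuum.Crystallization.Theorems.PricedLinkCensusTruncatedCensusGap

end
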